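import Summits.BirchSwinnertonDyer.BirchSwinnertonDyer.Theorems.UniversalToricDescentTwinAlgMuZeroAtThreeUnitPairs
import Summits.BirchSwinnertonDyer.Rank1Residual.X11b.CastellaErratumHeegner
import Literature.NumberTheory.EllipticCurves.HeegnerPointsKolyvaginProofs
import Literature.NumberTheory.EllipticCurves.HeegnerPointsKolyvaginTorsionProofs
import HarnessLib

/-!
# Route `UniversalToricDescent`, crux `TwinAlgMuZeroAtThree` (stmt-BirchSwinnertonDyer-24737, R2 text): its conclusion
# at a `3`-INDIVISIBLE HEEGNER POINT of `3`-adic log order one — tier U with the Mordell–Weil / Ш / index numerics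
# REPLACED by Kolyvagin's theorem (Gross 1991 Prop. 2.1, cited predicate) and one divisibility check

Width prover `bsd-wall-utd-p1-w2` g8 (cell `bsd-wall`), `--supports stmt-BirchSwinnertonDyer-24737`. THEOREMS ONLY (no
definition, no named fact minted, no `sorry`). Sequel of `…TwinAlgMuZeroAtThreeUnitPairs` (p728796).

The unit-pair instances of the tree (`selmerHalf_instance_of_mult_unit` / `…_of_goodSS_unit`, utd-p2 g3; read into the
item's currency by `twinAlgMu_at_mult_unit` / `twinAlgMu_at_goodSS_unit`) carry FOUR arithmetic binders on the pair
`(W′, K)`: a non-torsion `P ∈ W′(K)`, `rank W′(K) = 1`, `Ш(W′/K)[3^∞] = 0`, `3 ∤ [W′(K) : ℤP]` — «at a unit Heegner pair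
these are Gross 1991 Props. 2.1/2.3 at `p = 3`» (docstring of `…TwinSplitUnitPairSelmerHalf`), a reduction stated there
but not carried out in the tree. This file carries it out:

* §1 two elementary lemmas — `primaryComponent_eq_bot_of_forall_smul_eq_zero` (`G[p] = 0 ⟹ G[p^∞] = 0`) and
  `not_isOfFinAddOrder_of_not_exists_smul_eq` (`A[p] = 0` and `P ∉ pA` ⟹ `P` has infinite order);
* §2 `baseSelmer_exponent_eq_zero` — in the X11b exact count `a = ord₃ #Ш[3^∞] + 2((ord₃ log P − 1) − ord₃ [W′(K):ℤP])
  + ord₃ ∏_{w∣3} c_w` (an identity in `ℤ` with `a : ℕ`), `ord₃ log P = 1`, `Ш[3] = 0` and `3 ∤ ∏ c_w` FORCE `a = 0` (and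
  `3 ∤` the index): the index binder of the unit-pair instances is redundant;
* §3 **`twinAlgMu_at_heegnerPoint_mult_of_gross21`** (bucket B) / **`twinAlgMu_at_heegnerPoint_goodSS_of_gross21`**
  (bucket C₀): for `W′` in the bucket with `ρ̄_{W′,3}` onto and conductor `N′`, `K` imaginary quadratic Heegner for
  `N′` with `d_K` odd, `κ`, `γ`, a degree-one `𝔭′ ∣ 3`, and a HEEGNER POINT `P = y_K ∈ W′(K)` (`IsHeegnerPoint N′ W′ K P`)
  with `3 ∤ y_K` in `W′(K)` and `ord₃ log_ω y_K = 1` at `𝔭′`, `3 ∤ ∏_w c_w(W′/K)`: GRANTED Gross 1991 Prop. 2.1 for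
  `(N′, W′, K)` (the tree's cited predicate `Gross1991_prop_2_1`, = Kolyvagin at `p = 3`; in the tree it is reduced to
  `Gross1991_kolyvaginClasses ∧ Gross1991_prop_8_2`, `HeegnerPointsKolyvaginProp21Proofs`), the conclusion of
  `TwinAlgMuZeroAtThree` holds at `(W′, K, κ, γ, 𝔭′)`. Poitou–Tate and local Euler–Poincaré are theorems (discharged
  in the prequel); `E′(K)[3] = 0` is the tree's `torsionBy_eq_bot_of_isImaginaryQuadratic`; `d_K ≠ −3` from `3` split
  (`not_dvd_discr_of_splitsIn`), `d_K ≠ −4` from `d_K` odd; non-CM from the multiplicative prime (bucket B,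
  `not_mult_of_hasCM`) resp. a binder (bucket C₀).

(Sequel `…TwinAlgMuZeroAtThreeUnitHeegnerPairs`: the binder `3 ∤ y_K` follows from `ord₃ log_ω y_K = 1`.)

HONEST FRAMING: per-pair theorems (tier U), CONDITIONAL on the displayed cited predicate `Gross1991_prop_2_1 N′ W′ K`
(Kolyvagin at `p = 3`); the remaining per-pair inputs are three checks (`3 ∤ y_K` in `W′(K)`, `ord₃ log_ω y_K = 1`, `3 ∤ ∏ c_w`) and,
on C₀, non-CM. They do NOT close the ∀-item 24737; no class count moves; BSD is proved for no curve by this file.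

References: [GrossLMS1991] §2 Prop. 2.1; [JetchevSkinnerWan2017] Prop. 3.2.1, (7.1.5); [GreenbergLNM1716] §3–§4;
[MilneADT2006] I Thm. 2.8, Thm. 4.10 (b).
-/

set_option linter.dupNamespace false
set_option autoImplicit false

noncomputable section

open scoped Classical

open NumberField IsDedekindDomain Field
open Literature.NumberTheory.EllipticCurves Literature.NumberTheory.EllipticCurves.GreenbergSelmer
open Literature.NumberTheory.GaloisRepresentations

namespace Summit.BirchSwinnertonDyer.BirchSwinnertonDyer.Theorems.UniversalToricDescentTwinAlgMuUnitPairs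

open Summit.BirchSwinnertonDyer.Rank1Residual.X11b
open Summit.BirchSwinnertonDyer.Rank1Residual.X11b.AcSelmer
open Summit.BirchSwinnertonDyer.Rank1Residual.X11b.Halves
open Literature.NumberTheory.EllipticCurves.Rank1Residual
open Summit.BirchSwinnertonDyer.BirchSwinnertonDyer.Theorems.UniversalToricDescentTwinSplit.VanishingControl

/-! ## §1 Two elementary lemmas on torsion -/

section Elementary

variable {A : Type*} [AddCommGroup A]

/-- `G[p] = 0 ⟹ G[p^∞] = 0`: if no non-zero element is killed by `p`, the `p`-primary component is trivial
(induction on the exponent). [folklore] -/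
theorem primaryComponent_eq_bot_of_forall_smul_eq_zero (p : ℕ) [Fact p.Prime]
    (h : ∀ c : A, p • c = 0 → c = 0) : AddCommGroup.primaryComponent A p = ⊥ := by
  refine (AddSubgroup.eq_bot_iff_forall _).mpr fun x hx ↦ ?_
  obtain ⟨n, hn⟩ := (AddCommGroup.mem_primaryComponent).mp hx
  induction n generalizing x with
  | zero => simpa using hn
  | succ n ih =>
    have hpx : p ^ n • (p • x) = 0 := by rw [← mul_nsmul', ← pow_succ, hn]
    have hmem : p • x ∈ AddCommGroup.primaryComponent A p :=
      (AddCommGroup.mem_primaryComponent).mpr ⟨n, hpx⟩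
    exact h x (ih (p • x) hmem hpx)

/-- `A[p] = 0` and `P ∉ pA` ⟹ `P` has infinite order: a torsion point of order `m` is `p`-divisible when `p ∤ m`
(Bézout: `P = p • (a • P)` for `a p + b m = 1`), and yields a non-zero point killed by `p` when `p ∣ m`. [folklore] -/
theorem not_isOfFinAddOrder_of_not_exists_smul_eq {p : ℕ} (hp : p.Prime)
    (htors : AddSubgroup.torsionBy A (p : ℤ) = ⊥) {P : A} (hdiv : ¬ ∃ Q : A, p • Q = P) :
    ¬ IsOfFinAddOrder P := by
  intro hfin
  have hm0 : 0 < addOrderOf P := hfin.addOrderOf_pos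
  have hmP : addOrderOf P • P = 0 := addOrderOf_nsmul_eq_zero P
  by_cases hpm : p ∣ addOrderOf P
  · -- `(m / p) • P` is a non-zero point killed by `p`
    obtain ⟨k, hk⟩ := hpm
    have hk0 : 0 < k := Nat.pos_of_ne_zero fun h0 ↦ by rw [h0, mul_zero] at hk; omega
    have hkP : p • (k • P) = 0 := by rw [← mul_nsmul, mul_comm k p, ← hk]; exact hmP
    have hmem : k • P ∈ AddSubgroup.torsionBy A (p : ℤ) := AddSubgroup.torsionBy.nsmul_iff.mpr hkP
    rw [htors, AddSubgroup.mem_bot] at hmem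
    have hle : addOrderOf P ≤ k := addOrderOf_le_of_nsmul_eq_zero hk0 hmem
    have hlt : k < addOrderOf P := by rw [hk]; exact lt_mul_left hk0 hp.one_lt
    omega
  · -- Bézout: `a p + b m = 1`, so `P = p • (a • P)`
    have hcop : IsCoprime (p : ℤ) (addOrderOf P : ℤ) :=
      Nat.isCoprime_iff_coprime.mpr ((Nat.Prime.coprime_iff_not_dvd hp).mpr hpm)
    obtain ⟨a, b, hab⟩ := hcop
    refine hdiv ⟨a • P, ?_⟩
    have hmZ : (addOrderOf P : ℤ) • P = 0 := by rw [natCast_zsmul]; exact hmP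
    calc p • (a • P) = ((p : ℤ) * a) • P := by rw [← natCast_zsmul, smul_smul]
      _ = (a * (p : ℤ) + b * (addOrderOf P : ℤ)) • P := by
          rw [add_zsmul, mul_comm a, mul_smul b, hmZ, smul_zero, add_zero]
      _ = P := by rw [hab, one_zsmul]

end Elementary

/-! ## §2 The exact count at `ord₃ log_ω P = 1`: the index binder is redundant -/

/-- **In the X11b exact count, `ord₃ log P = 1`, `Ш[3^∞] = 0` and `3 ∤ ∏_{w∣3} c_w` force the exponent to be `0`**
(and `3 ∤ [W′(K) : ℤP]`): `a = 0 + 2((1 − 1) − v) + 0 = −2v` with `a ≥ 0`. Pure arithmetic on `BaseSelmerCountAt`.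
[cite: JetchevSkinnerWan2017, Prop. 3.2.1 and (7.1.5)] -/
theorem baseSelmer_card_eq_one_of_count {K : Type} [Field K] [NumberField K]
    {W' : WeierstrassCurve ℚ} [W'.IsElliptic] [W'.IsGloballyMinimal]
    {𝔭' : HeightOneSpectrum (𝓞 K)} {ι : K →+* ℚ_[3]} {P : (W'.baseChange K).toAffine.Point}
    (hcount : BaseSelmerCountAt 3 𝔭' ι P)
    (hlog : Summit.BirchSwinnertonDyer.Rank1Residual.X11b.padicLogOrd W' 3 ι P = 1)
    (hSha : AddCommGroup.primaryComponent (W'.baseChange K).sha 3 = ⊥)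
    (htam : ¬ 3 ∣ tamagawaProductAbove W' K 3) :
    ∃ _ : Finite (selmerAcBase (W'.baseChange K) 3 𝔭' ∅), Nat.card (selmerAcBase (W'.baseChange K) 3 𝔭' ∅) = 1 := by
  obtain ⟨a, ⟨hfin, hcard⟩, ha⟩ := hcount
  have h1 : padicValNat 3 (Nat.card (AddCommGroup.primaryComponent (W'.baseChange K).sha 3)) = 0 := by
    rw [hSha, AddSubgroup.card_bot]; simp
  have h3 : padicValNat 3 (tamagawaProductAbove W' K 3) = 0 := padicValNat.eq_zero_of_not_dvd htam
  rw [h1, h3, hlog] at ha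
  have hv : (0 : ℤ) ≤ (padicValNat 3 (AddSubgroup.zmultiples P).index : ℤ) := Int.natCast_nonneg _
  have ha0 : a = 0 := by
    simp only [Nat.cast_zero, zero_add, add_zero, sub_self, zero_sub, mul_neg] at ha
    omega
  rw [ha0, pow_zero] at hcard
  exact ⟨hfin, hcard⟩

/-! ## §3 Item 24737's conclusion at a `3`-indivisible Heegner point of log order one, GRANTED Gross 1991 Prop. 2.1 -/

/-- For an imaginary quadratic `K` with `d_K` odd in which `3` splits, `d_K ∉ {−3, −4}` (Gross's standing restriction).
[folklore] -/
theorem discr_ne_of_odd_of_splitsIn {K : Type} [Field K] [NumberField K] (hK : IsImaginaryQuadratic K)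
    (hodd : Odd (NumberField.discr K)) (hsplit : SplitsIn K 3) :
    NumberField.discr K ≠ -3 ∧ NumberField.discr K ≠ -4 := by
  have h3 : ¬ ((3 : ℕ) : ℤ) ∣ NumberField.discr K :=
    not_dvd_discr_of_splitsIn (IsImaginaryQuadratic.finrank_eq_two hK) Nat.prime_three hsplit
  refine ⟨fun h ↦ h3 ⟨-1, by rw [h]; norm_num⟩, fun h ↦ ?_⟩
  rw [h] at hodd
  exact (Int.not_odd_iff_even.mpr ⟨-2, by norm_num⟩) hodd

/-- **Bucket B (multiplicative at `3`, très ramifié or non-split) at a HEEGNER POINT: the conclusion of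
`TwinAlgMuZeroAtThree` (item 24737, R2 text) HOLDS at `(W′, K, κ, γ, 𝔭′)` GRANTED Gross 1991 Prop. 2.1 for `(N′, W′, K)`**
— for `W′/ℚ` multiplicative at `3` with `ρ̄_{W′,3}` onto and conductor `N′`, `K` imaginary quadratic Heegner for `N′` with
`d_K` odd, any `ℤ₃`-extension `κ` with topological generator `γ`, a degree-one `𝔭′ ∣ 3`, and a Heegner point
`P = y_K ∈ W′(K)` with `3 ∤ y_K` in `W′(K)`, `ord₃ log_ω y_K = 1` at `𝔭′`, `3 ∤ ∏_w c_w(W′/K)`: `X_ac(W′/K_∞)` strict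
at `𝔭′` is `Λ`-torsion and `Ch_Λ·R₀⟦T⟧ = (g′)` with a norm-one coefficient. Kolyvagin (the cited predicate
`Gross1991_prop_2_1`, at `p = 3`: `rank W′(K) = 1`, `Ш(W′/K)[3] = 0`; non-CM from the multiplicative prime, `E′(K)[3] = 0`
from the image, `d_K ∉ {−3,−4}` from `3` split and `d_K` odd) feeds the X11b exact count (Poitou–Tate and local
Euler–Poincaré are tree theorems), whose exponent is then `0` (`baseSelmer_card_eq_one_of_count`); vanishing control
finishes. CONDITIONAL on the displayed predicate only. [cite: GrossLMS1991, §2 Prop. 2.1]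
[cite: JetchevSkinnerWan2017, Prop. 3.2.1 and (7.1.5)] [cite: GreenbergLNM1716, §3 Lemma 3.3, §4] -/
theorem twinAlgMu_at_heegnerPoint_mult_of_gross21 (K : Type) [Field K] [NumberField K]
    (W' : WeierstrassCurve ℚ) [W'.IsElliptic] [W'.IsGloballyMinimal] (N' : ℕ) [NeZero N']
    (h21 : Gross1991_prop_2_1 N' W' K)
    (hm : Mult W' 3)
    (hside : ¬ W'.HasSplitMultiplicativeReductionAtPrime 3 ∨
      ¬ 3 ∣ padicValInt 3 W'.minimalDiscriminantInt)
    (hsurj : W'.HasSurjectiveModNGaloisRep 3) (hN' : W'.conductorNorm ℤ = N')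
    (hK : IsImaginaryQuadratic K) (hH : SatisfiesHeegnerHypothesis N' K) (hodd : Odd (NumberField.discr K))
    (κ : ZpExtension K 3) (γ : absoluteGaloisGroup K) [Fact (κ.IsTopGenerator γ)]
    (𝔭' : HeightOneSpectrum (𝓞 K)) (h𝔭' : ((3 : ℕ) : 𝓞 K) ∈ 𝔭'.asIdeal)
    (he' : 𝔭'.asIdeal.ramificationIdx (𝓞 ℚ) = 1) (hf' : 𝔭'.asIdeal.inertiaDeg (𝓞 ℚ) = 1)
    (P : (W'.baseChange K).toAffine.Point) (hP : IsHeegnerPoint N' W' K P)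
    (hndiv : ¬ ∃ Q : (W'.baseChange K).toAffine.Point, 3 • Q = P)
    (hlog : Literature.NumberTheory.EllipticCurves.padicLogOrd W' 3 (embAt K 3 𝔭' h𝔭' he' hf') P = 1)
    (htam : ¬ 3 ∣ (W'.baseChange K).tamagawaProduct) :
    Module.IsTorsion (IwasawaAlgebra 3) (XAc (W'.baseChange K) 3 κ 𝔭' ∅ γ) ∧
      ∃ g' : UnrSeries 3,
        (XAc.charIdeal (W'.baseChange K) 3 κ 𝔭' ∅ γ).map (PowerSeries.map (toUnr 3)) = Ideal.span {g'} ∧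
          ∃ i : ℕ, ‖((PowerSeries.coeff i g' : unrIntegers 3) : ℂ_[3])‖ = 1 := by
  haveI : IsTotallyComplex K := IsImaginaryQuadratic.isTotallyComplex hK
  haveI : (W'.baseChange K).IsElliptic := by rw [WeierstrassCurve.baseChange]; infer_instance
  have hirr : Irr W' 3 := hasIrreducibleModPGaloisRep_of_hasSurjectiveModNGaloisRep W' 3 hsurj
  have hsplit : SplitsIn K 3 := hH 3 Nat.prime_three (hN' ▸ dvd_conductorNorm_of_mult hm)
  have hiv : ∀ R : (W'.baseChange ℚ_[3]).toAffine.Point, 3 • R = 0 → R = 0 :=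
    LocalTorsionMult.localTorsion_eq_zero_of_mult W' 3 le_rfl hm hside
  -- Gross 1991 Prop. 2.1 at `p = 3`
  have hncm : ¬ W'.HasCM := fun hCM ↦ not_mult_of_hasCM W' hCM 3 hm
  have hD := discr_ne_of_odd_of_splitsIn hK hodd hsplit
  obtain ⟨hrk, hsha3⟩ := h21 hncm hK hD hH hP Nat.prime_three (by norm_num) hsurj hndiv
  have hSha : AddCommGroup.primaryComponent (W'.baseChange K).sha 3 = ⊥ :=
    primaryComponent_eq_bot_of_forall_smul_eq_zero 3 hsha3
  have hShafin : Finite (AddCommGroup.primaryComponent (W'.baseChange K).sha 3) := by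
    rw [hSha]; infer_instance
  have hP0 : ¬ IsOfFinAddOrder P :=
    not_isOfFinAddOrder_of_not_exists_smul_eq Nat.prime_three
      (torsionBy_eq_bot_of_isImaginaryQuadratic W' K hK Nat.prime_three (by norm_num) hsurj) hndiv
  -- the exact count, Poitou–Tate and local Euler–Poincaré being theorems
  have hcount := baseSelmerCountAt_of_rankOne_primary W' 3 K
    (SchneiderFreeAdditiveX3.PoitouTateReduction.poitouTate_selmerStructure_duality_holds K)
    (fun v ↦ Summit.BirchSwinnertonDyer.Rank1Residual.GaloisImage.EP.localEulerPoincareCharacteristic_adicCompletion K v)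
    hm hirr hK hsplit hiv hrk hShafin P hP0 𝔭' h𝔭' he' hf'
  have hlog' : Summit.BirchSwinnertonDyer.Rank1Residual.X11b.padicLogOrd W' 3 (embAt K 3 𝔭' h𝔭' he' hf') P = 1 := hlog
  obtain ⟨hfin, hcard⟩ := baseSelmer_card_eq_one_of_count hcount hlog' hSha
    (fun h ↦ htam (h.trans (tamagawaProductAbove_dvd_tamagawaProduct W' K 3)))
  haveI := hfin
  exact isTorsion_and_exists_generator_of_hasCharValuationAt_zero (W'.baseChange K) 3 κ 𝔭' ∅ γ
    (hasCharValuationAt_zero_of_atoms (W'.baseChange K) 3 κ 𝔭' γ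
      (noThreeTorsionAtPrime_of_mult W' hm hside K 𝔭' h𝔭' he' hf')
      (fun v hv ↦ localKer_eq_bot_of_not_dvd_tamagawaProduct (W'.baseChange K) 3 κ htam hv)
      (AddSubgroup.eq_bot_of_card_eq _ hcard))

/-- **Bucket C₀ (good supersingular at `3`) at a HEEGNER POINT: the conclusion of `TwinAlgMuZeroAtThree` (item 24737,
R2 text) HOLDS at `(W′, K, κ, γ, 𝔭′)` GRANTED Gross 1991 Prop. 2.1 for `(N′, W′, K)`** — for non-CM `W′/ℚ` good
supersingular at `3` with `ρ̄_{W′,3}` onto and conductor `N′`, `K` imaginary quadratic Heegner for `N′` with `d_K` odd,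
`κ`, `γ`, a degree-one `𝔭′ ∣ 3`, and a Heegner point `P = y_K` with `3 ∤ y_K` in `W′(K)`, `ord₃ log_ω y_K = 1` at `𝔭′`,
`3 ∤ ∏_w c_w(W′/K)`. (`a₃ = 0` is not needed; non-CM is a binder here — a CM curve can be supersingular at `3`.)
CONDITIONAL on the displayed predicate only. [cite: GrossLMS1991, §2 Prop. 2.1]
[cite: JetchevSkinnerWan2017, Prop. 3.2.1 and (7.1.5)] [cite: Kim2022StructureSelmer, §3.1.1] -/
theorem twinAlgMu_at_heegnerPoint_goodSS_of_gross21 (K : Type) [Field K] [NumberField K]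
    (W' : WeierstrassCurve ℚ) [W'.IsElliptic] [W'.IsGloballyMinimal] (N' : ℕ) [NeZero N']
    (h21 : Gross1991_prop_2_1 N' W' K) (hncm : ¬ W'.HasCM)
    (hss : GoodSS W' 3) (hsurj : W'.HasSurjectiveModNGaloisRep 3)
    (hK : IsImaginaryQuadratic K) (hH : SatisfiesHeegnerHypothesis N' K) (hodd : Odd (NumberField.discr K))
    (κ : ZpExtension K 3) (γ : absoluteGaloisGroup K) [Fact (κ.IsTopGenerator γ)]
    (𝔭' : HeightOneSpectrum (𝓞 K)) (h𝔭' : ((3 : ℕ) : 𝓞 K) ∈ 𝔭'.asIdeal)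
    (he' : 𝔭'.asIdeal.ramificationIdx (𝓞 ℚ) = 1) (hf' : 𝔭'.asIdeal.inertiaDeg (𝓞 ℚ) = 1)
    (P : (W'.baseChange K).toAffine.Point) (hP : IsHeegnerPoint N' W' K P)
    (hndiv : ¬ ∃ Q : (W'.baseChange K).toAffine.Point, 3 • Q = P)
    (hlog : Literature.NumberTheory.EllipticCurves.padicLogOrd W' 3 (embAt K 3 𝔭' h𝔭' he' hf') P = 1)
    (htam : ¬ 3 ∣ (W'.baseChange K).tamagawaProduct) :
    Module.IsTorsion (IwasawaAlgebra 3) (XAc (W'.baseChange K) 3 κ 𝔭' ∅ γ) ∧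
      ∃ g' : UnrSeries 3,
        (XAc.charIdeal (W'.baseChange K) 3 κ 𝔭' ∅ γ).map (PowerSeries.map (toUnr 3)) = Ideal.span {g'} ∧
          ∃ i : ℕ, ‖((PowerSeries.coeff i g' : unrIntegers 3) : ℂ_[3])‖ = 1 := by
  haveI : IsTotallyComplex K := IsImaginaryQuadratic.isTotallyComplex hK
  haveI : (W'.baseChange K).IsElliptic := by rw [WeierstrassCurve.baseChange]; infer_instance
  have hirr : Irr W' 3 := hasIrreducibleModPGaloisRep_of_hasSurjectiveModNGaloisRep W' 3 hsurj
  have hred : ¬ 3 ∣ W'.reductionPointCount 3 := not_dvd_reductionPointCount_of_goodSS W' hss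
  have hsplit : SplitsIn K 3 := by
    have h := (splitsIn_primesEquiv_under_iff (IsImaginaryQuadratic.finrank_eq_two hK) 𝔭').mpr
      ⟨he', hf'⟩
    rwa [under_eq_ratPlace_of_mem h𝔭', primesEquiv_ratPlace] at h
  have hiv : ∀ R : (W'.baseChange ℚ_[3]).toAffine.Point, 3 • R = 0 → R = 0 :=
    localTorsion_eq_zero_of_good_of_not_dvd_frobeniusTrace_sub_one W' 3 le_rfl hss.1 fun h1 ↦
      hred ((dvd_reductionPointCount_iff_dvd_frobeniusTrace_sub_one W' 3).mpr h1)
  -- Gross 1991 Prop. 2.1 at `p = 3`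
  have hD := discr_ne_of_odd_of_splitsIn hK hodd hsplit
  obtain ⟨hrk, hsha3⟩ := h21 hncm hK hD hH hP Nat.prime_three (by norm_num) hsurj hndiv
  have hSha : AddCommGroup.primaryComponent (W'.baseChange K).sha 3 = ⊥ :=
    primaryComponent_eq_bot_of_forall_smul_eq_zero 3 hsha3
  have hShafin : Finite (AddCommGroup.primaryComponent (W'.baseChange K).sha 3) := by
    rw [hSha]; infer_instance
  have hP0 : ¬ IsOfFinAddOrder P :=
    not_isOfFinAddOrder_of_not_exists_smul_eq Nat.prime_three
      (torsionBy_eq_bot_of_isImaginaryQuadratic W' K hK Nat.prime_three (by norm_num) hsurj) hndiv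
  have hcount := baseSelmerCountAt_of_rankOne_primary_red W' 3 K
    (SchneiderFreeAdditiveX3.PoitouTateReduction.poitouTate_selmerStructure_duality_holds K)
    (fun v ↦ Summit.BirchSwinnertonDyer.Rank1Residual.GaloisImage.EP.localEulerPoincareCharacteristic_adicCompletion K v)
    hred hirr hK hsplit hiv hrk hShafin P hP0 𝔭' h𝔭' he' hf'
  have hlog' : Summit.BirchSwinnertonDyer.Rank1Residual.X11b.padicLogOrd W' 3 (embAt K 3 𝔭' h𝔭' he' hf') P = 1 := hlog
  obtain ⟨hfin, hcard⟩ := baseSelmer_card_eq_one_of_count hcount hlog' hSha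
    (fun h ↦ htam (h.trans (tamagawaProductAbove_dvd_tamagawaProduct W' K 3)))
  haveI := hfin
  exact isTorsion_and_exists_generator_of_hasCharValuationAt_zero (W'.baseChange K) 3 κ 𝔭' ∅ γ
    (hasCharValuationAt_zero_of_atoms (W'.baseChange K) 3 κ 𝔭' γ
      (noThreeTorsionAtPrime_of_goodSS W' hss K 𝔭' h𝔭' he' hf')
      (fun v hv ↦ localKer_eq_bot_of_not_dvd_tamagawaProduct (W'.baseChange K) 3 κ htam hv)
      (AddSubgroup.eq_bot_of_card_eq _ hcard))

end Summit.BirchSwinnertonDyer.BirchSwinnertonDyer.Theorems.UniversalToricDescentTwinAlgMuUnitPairs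

end
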